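import Mathlib
import Literature.NumberTheory.Transcendental.KZCalculusProofs
import Literature.NumberTheory.Transcendental.SemialgebraicMapsProofs
import Literature.NumberTheory.Transcendental.KZRelationsLE
import Literature.NumberTheory.Transcendental.KZSubcalculusInvariants

/-!
# `VolumeFormOffPlane` (stmt-KontsevichZagierPeriods-14935) — line `Sketch`,
stub `stub_powerMove` (the monomial power map is one rule-(2) move, `|det| = i·j`)

Dimension `3`, coordinates `x = p 0`, `y = p 1`, slack `z = p 2`. For `i, j ≥ 1` the monomial map
`Ψ (x, y, z) = (xⁱ, yʲ, z·xy/(xⁱyʲ))` is a bijection of the open region `Q = {x > 0, y > 0}` onto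
itself (inverse by `i`-th / `j`-th roots); in logarithmic coordinates it is the linear map
`diag(i, j)` on the first two coordinates. Its Jacobian matrix is lower triangular with diagonal
`(i xⁱ⁻¹, j yʲ⁻¹, xy/(xⁱyʲ))`, so `det Ψ' = i·j` is a positive CONSTANT on `Q`.

Given two integrand-`1` representations `r`, `r'` with domains inside `Q` such that membership is
transported by `Ψ` (`p ∈ σ ↔ Ψ p ∈ σ'` on `Q`), we get `σ' = Ψ '' σ` and `InjOn Ψ σ`, and ONE
change-of-variables generator (`KZ.changeOfVariablesRel`, rule (2) of [Kontsevich–Zagier 2001,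
§1.2]) between `r₂ = (i·j) · r` (the scaled representation `KZ.IntegralRep.constMul`, integrand
`(i·j)·1 = 1·|i·j|`) and `r'`. Combined with the bookkeeping congruence
`[σ, k f] ≡ k•[σ, f]` (`KZ.IntegralRep.of_constMul_nat_sub_nsmul_mem_relations`, rule (1b)) this
gives `[r'] − (i·j)•[r] ∈ KZ.relations`.

Sources: M. Kontsevich, D. Zagier, *Periods* (2001), §1.2 rules (1), (2). The Jacobian bookkeeping
is folklore; the shape of the witness follows
`Summits/…/Theorems/SymplecticScissorsVolumeFormPerspectiveMap.lean`.
-/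

noncomputable section

open MeasureTheory Set MvPolynomial
open Literature.NumberTheory.Transcendental Literature.ModelTheory.ExponentialFields

namespace Summit.KontsevichZagierPeriods.SymplecticScissors.LogPolytope

/-! ## Derivatives of the coordinates of the power map -/

/-- The derivative of `p ↦ (p k) ^ n` is `v ↦ n (x k)ⁿ⁻¹ v k`. [folklore] -/
theorem pmv_hasFDerivAt_pow (k : Fin 3) (n : ℕ) (x : Fin 3 → ℝ) :
    HasFDerivAt (fun p : Fin 3 → ℝ => p k ^ n)
      (((n : ℝ) * x k ^ (n - 1)) •
        ContinuousLinearMap.proj (R := ℝ) (φ := fun _ : Fin 3 => ℝ) k) x := by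
  have hk : HasFDerivAt (fun p : Fin 3 → ℝ => p k)
      (ContinuousLinearMap.proj (R := ℝ) (φ := fun _ : Fin 3 => ℝ) k) x := hasFDerivAt_apply k x
  exact (hasDerivAt_pow n (x k)).comp_hasFDerivAt x hk

/-- The derivative of `p ↦ p k / (p k) ^ n` at a point with `x k ≠ 0` is a multiple of the
coordinate form `v ↦ v k`. [folklore] -/
theorem pmv_hasFDerivAt_divPow (k : Fin 3) (n : ℕ) (x : Fin 3 → ℝ) (hx : x k ≠ 0) :
    HasFDerivAt (fun p : Fin 3 → ℝ => p k / p k ^ n)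
      (deriv (fun s : ℝ => s / s ^ n) (x k) •
        ContinuousLinearMap.proj (R := ℝ) (φ := fun _ : Fin 3 => ℝ) k) x := by
  have hk : HasFDerivAt (fun p : Fin 3 → ℝ => p k)
      (ContinuousLinearMap.proj (R := ℝ) (φ := fun _ : Fin 3 => ℝ) k) x := hasFDerivAt_apply k x
  have hd : DifferentiableAt ℝ (fun s : ℝ => s / s ^ n) (x k) := by
    fun_prop (disch := exact pow_ne_zero n hx)
  exact hd.hasDerivAt.comp_hasFDerivAt x hk

/-- The derivative of the slack coordinate `p ↦ p 2 · (p 0 · p 1) / ((p 0)ⁱ (p 1)ʲ)` of the power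
map at a point with `x 0 ≠ 0`, `x 1 ≠ 0`: by the product rule applied to
`p 2 · ((p 0 / (p 0)ⁱ) · (p 1 / (p 1)ʲ))`, a combination of the three coordinate forms whose
`v ↦ v 2` coefficient is `x 0 x 1 / ((x 0)ⁱ (x 1)ʲ)`. [folklore] -/
theorem pmv_hasFDerivAt_slack (i j : ℕ) (x : Fin 3 → ℝ) (h0 : x 0 ≠ 0) (h1 : x 1 ≠ 0) :
    HasFDerivAt (fun p : Fin 3 → ℝ => p 2 * (p 0 * p 1) / (p 0 ^ i * p 1 ^ j))
      (x 2 • ((x 0 / x 0 ^ i) • (deriv (fun s : ℝ => s / s ^ j) (x 1) •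
            ContinuousLinearMap.proj (R := ℝ) (φ := fun _ : Fin 3 => ℝ) 1) +
          (x 1 / x 1 ^ j) • (deriv (fun s : ℝ => s / s ^ i) (x 0) •
            ContinuousLinearMap.proj (R := ℝ) (φ := fun _ : Fin 3 => ℝ) 0)) +
        (x 0 / x 0 ^ i * (x 1 / x 1 ^ j)) •
          ContinuousLinearMap.proj (R := ℝ) (φ := fun _ : Fin 3 => ℝ) 2) x := by
  have hfun : (fun p : Fin 3 → ℝ => p 2 * (p 0 * p 1) / (p 0 ^ i * p 1 ^ j)) =
      fun p => p 2 * (p 0 / p 0 ^ i * (p 1 / p 1 ^ j)) := by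
    funext p
    rw [mul_div_assoc, mul_div_mul_comm]
  have h2 : HasFDerivAt (fun p : Fin 3 → ℝ => p 2)
      (ContinuousLinearMap.proj (R := ℝ) (φ := fun _ : Fin 3 => ℝ) 2) x := hasFDerivAt_apply 2 x
  rw [hfun]
  exact h2.fun_mul ((pmv_hasFDerivAt_divPow 0 i x h0).fun_mul (pmv_hasFDerivAt_divPow 1 j x h1))

/-- **The Jacobian determinant of the power map is the constant `i·j`.** The derivative
`pi (i xⁱ⁻¹ • pr₀, j yʲ⁻¹ • pr₁, z • (…pr₀, pr₁…) + (x/xⁱ · y/yʲ) • pr₂)` has a lower-triangular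
matrix with diagonal `(i xⁱ⁻¹, j yʲ⁻¹, x y /(xⁱ yʲ))`, whose product is `i·j` (`x, y ≠ 0`,
`i, j ≥ 1`). [folklore] -/
theorem pmv_det (i j : ℕ) (hi : i ≠ 0) (hj : j ≠ 0) (x : Fin 3 → ℝ) (h0 : x 0 ≠ 0)
    (h1 : x 1 ≠ 0) :
    (ContinuousLinearMap.pi (![((i : ℝ) * x 0 ^ (i - 1)) •
          ContinuousLinearMap.proj (R := ℝ) (φ := fun _ : Fin 3 => ℝ) 0,
        ((j : ℝ) * x 1 ^ (j - 1)) •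
          ContinuousLinearMap.proj (R := ℝ) (φ := fun _ : Fin 3 => ℝ) 1,
        x 2 • ((x 0 / x 0 ^ i) • (deriv (fun s : ℝ => s / s ^ j) (x 1) •
              ContinuousLinearMap.proj (R := ℝ) (φ := fun _ : Fin 3 => ℝ) 1) +
            (x 1 / x 1 ^ j) • (deriv (fun s : ℝ => s / s ^ i) (x 0) •
              ContinuousLinearMap.proj (R := ℝ) (φ := fun _ : Fin 3 => ℝ) 0)) +
          (x 0 / x 0 ^ i * (x 1 / x 1 ^ j)) •
            ContinuousLinearMap.proj (R := ℝ) (φ := fun _ : Fin 3 => ℝ) 2] :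
          Fin 3 → (Fin 3 → ℝ) →L[ℝ] ℝ) :
        (Fin 3 → ℝ) →L[ℝ] (Fin 3 → ℝ)).det = (i : ℝ) * j := by
  rw [ContinuousLinearMap.det, ← LinearMap.det_toMatrix', Matrix.det_fin_three]
  simp only [LinearMap.toMatrix'_apply, ContinuousLinearMap.coe_coe, ContinuousLinearMap.pi_apply,
    Matrix.cons_val_zero, Matrix.cons_val_one, Matrix.cons_val_two, Matrix.head_cons,
    Matrix.tail_cons, _root_.add_apply, _root_.smul_apply,
    ContinuousLinearMap.proj_apply, Pi.single_apply, smul_eq_mul]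
  simp only [Fin.isValue, Fin.reduceEq, ↓reduceIte, mul_one, mul_zero, add_zero, zero_add, zero_mul,
    sub_zero, zero_ne_one, one_ne_zero]
  rw [← pow_sub_one_mul hi (x 0), ← pow_sub_one_mul hj (x 1)]
  field_simp

/-! ## The move -/

/-- **The power move** (stub `stub_powerMove` of `VolumeFormOffPlane`, line `Sketch`,
stmt-KontsevichZagierPeriods-14935). For `i, j ≥ 1` and two integrand-`1` representations `r`, `r'`
in dimension `3` with domains inside `{x > 0, y > 0}` whose membership is transported by the
monomial map `Ψ (x, y, z) = (xⁱ, yʲ, z·xy/(xⁱyʲ))`, one has `[r'] − (i·j)•[r] ∈ KZ.relations`: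
`Ψ` is ONE rule-(2) move from the scaled representation `(i·j)·r` to `r'` (it is `ℚ`-semialgebraic,
injective on the open quadrant, differentiable with constant Jacobian determinant `i·j`, and
`σ' = Ψ '' σ`), and `[(i·j)·r] ≡ (i·j)•[r]` by integrand additivity.
[Kontsevich–Zagier 2001, §1.2, rules (1b), (2)] -/
theorem stub_powerMove : (∀ (i j : ℕ), 1 ≤ i → 1 ≤ j → ∀ (r r' : KZ.IntegralRep 3), r.domain ⊆ {p | 0 < p 0 ∧ 0 < p 1} → r'.domain ⊆ {p | 0 < p 0 ∧ 0 < p 1} → (∀ p : Fin 3 → ℝ, 0 < p 0 → 0 < p 1 → (p ∈ r.domain ↔ (![p 0 ^ i, p 1 ^ j, p 2 * (p 0 * p 1) / (p 0 ^ i * p 1 ^ j)] : Fin 3 → ℝ) ∈ r'.domain)) → (∀ p ∈ r.domain, r.integrand p = 1) → (∀ p ∈ r'.domain, r'.integrand p = 1) → KZ.of r' - (i * j) • KZ.of r ∈ KZ.relations) := by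
  intro i j hi hj r r' hr hr' hmem hf hf'
  have hi0 : i ≠ 0 := Nat.one_le_iff_ne_zero.mp hi
  have hj0 : j ≠ 0 := Nat.one_le_iff_ne_zero.mp hj
  -- the witness and its derivative
  let Φ : (Fin 3 → ℝ) → (Fin 3 → ℝ) := fun p =>
    ![p 0 ^ i, p 1 ^ j, p 2 * (p 0 * p 1) / (p 0 ^ i * p 1 ^ j)]
  let Φ' : (Fin 3 → ℝ) → (Fin 3 → ℝ) →L[ℝ] (Fin 3 → ℝ) := fun x =>
    ContinuousLinearMap.pi (![((i : ℝ) * x 0 ^ (i - 1)) •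
          ContinuousLinearMap.proj (R := ℝ) (φ := fun _ : Fin 3 => ℝ) 0,
        ((j : ℝ) * x 1 ^ (j - 1)) •
          ContinuousLinearMap.proj (R := ℝ) (φ := fun _ : Fin 3 => ℝ) 1,
        x 2 • ((x 0 / x 0 ^ i) • (deriv (fun s : ℝ => s / s ^ j) (x 1) •
              ContinuousLinearMap.proj (R := ℝ) (φ := fun _ : Fin 3 => ℝ) 1) +
            (x 1 / x 1 ^ j) • (deriv (fun s : ℝ => s / s ^ i) (x 0) •
              ContinuousLinearMap.proj (R := ℝ) (φ := fun _ : Fin 3 => ℝ) 0)) +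
          (x 0 / x 0 ^ i * (x 1 / x 1 ^ j)) •
            ContinuousLinearMap.proj (R := ℝ) (φ := fun _ : Fin 3 => ℝ) 2] :
          Fin 3 → (Fin 3 → ℝ) →L[ℝ] ℝ)
  have hΦ0 : ∀ p, Φ p 0 = p 0 ^ i := fun p => rfl
  have hΦ1 : ∀ p, Φ p 1 = p 1 ^ j := fun p => rfl
  have hΦ2 : ∀ p, Φ p 2 = p 2 * (p 0 * p 1) / (p 0 ^ i * p 1 ^ j) := fun p => rfl
  -- positivity on the source domain
  have hpos : ∀ p ∈ r.domain, 0 < p 0 ∧ 0 < p 1 := fun p hp => hr hp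
  -- the Jacobian determinant on the source domain
  have hdet : ∀ x ∈ r.domain, (Φ' x).det = (i : ℝ) * j := fun x hx =>
    pmv_det i j hi0 hj0 x (hpos x hx).1.ne' (hpos x hx).2.ne'
  -- `Φ` maps the source domain into the target domain
  have hmaps : ∀ p ∈ r.domain, Φ p ∈ r'.domain := fun p hp =>
    (hmem p (hpos p hp).1 (hpos p hp).2).1 hp
  -- `Φ` is onto the target domain: explicit inverse by `i`-th and `j`-th roots
  have hsurj : ∀ q ∈ r'.domain, ∃ p ∈ r.domain, Φ p = q := by
    intro q hq
    obtain ⟨hq0, hq1⟩ : 0 < q 0 ∧ 0 < q 1 := hr' hq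
    obtain ⟨a, hai, ha0⟩ : ∃ a : ℝ, a ^ i = q 0 ∧ 0 < a :=
      ⟨q 0 ^ ((i : ℝ)⁻¹), Real.rpow_inv_natCast_pow hq0.le hi0, Real.rpow_pos_of_pos hq0 _⟩
    obtain ⟨b, hbj, hb0⟩ : ∃ b : ℝ, b ^ j = q 1 ∧ 0 < b :=
      ⟨q 1 ^ ((j : ℝ)⁻¹), Real.rpow_inv_natCast_pow hq1.le hj0, Real.rpow_pos_of_pos hq1 _⟩
    let p : Fin 3 → ℝ := ![a, b, q 2 * (a ^ i * b ^ j) / (a * b)]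
    have hp0 : p 0 = a := rfl
    have hp1 : p 1 = b := rfl
    have hp2 : p 2 = q 2 * (a ^ i * b ^ j) / (a * b) := rfl
    have hΦp : Φ p = q := by
      funext k
      fin_cases k
      · show Φ p 0 = q 0
        rw [hΦ0, hp0, hai]
      · show Φ p 1 = q 1
        rw [hΦ1, hp1, hbj]
      · show Φ p 2 = q 2
        rw [hΦ2, hp0, hp1, hp2]
        field_simp
    refine ⟨p, (hmem p (hp0 ▸ ha0) (hp1 ▸ hb0)).2 ?_, hΦp⟩
    show Φ p ∈ r'.domain
    rw [hΦp]
    exact hq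
  -- assemble the rule-(2) witness between `(i·j)·r` and `r'`
  have hcov : KZ.of (r.constMul ((i * j : ℕ) : ℝ) (isAlgebraic_nat (i * j))) - KZ.of r' ∈
      KZ.changeOfVariablesRel := by
    refine ⟨3, r.constMul ((i * j : ℕ) : ℝ) (isAlgebraic_nat (i * j)), r', Φ, Φ',
      ?_, ?_, ?_, ?_, ?_, rfl⟩
    · -- `Φ` is `ℚ`-semialgebraic on the source domain
      show IsSemialgebraicMapOn ℚ r.domain Φ
      refine IsSemialgebraicMapOn.of_forall r.isSemialgebraic_domain fun k => ?_
      fin_cases k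
      · show IsSemialgebraicFunOn ℚ r.domain fun p => Φ p 0
        exact (isSemialgebraicFunOn_aeval r.isSemialgebraic_domain
          ((X 0 : MvPolynomial (Fin 3) ℚ) ^ i)).congr fun p _ => by
            simp only [map_pow, aeval_X, hΦ0]
      · show IsSemialgebraicFunOn ℚ r.domain fun p => Φ p 1
        exact (isSemialgebraicFunOn_aeval r.isSemialgebraic_domain
          ((X 1 : MvPolynomial (Fin 3) ℚ) ^ j)).congr fun p _ => by
            simp only [map_pow, aeval_X, hΦ1]
      · show IsSemialgebraicFunOn ℚ r.domain fun p => Φ p 2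
        have hq : ∀ p ∈ r.domain,
            aeval p ((X 0 : MvPolynomial (Fin 3) ℚ) ^ i * X 1 ^ j) ≠ (0 : ℝ) := by
          intro p hp
          obtain ⟨hp0, hp1⟩ := hpos p hp
          rw [map_mul, map_pow, map_pow, aeval_X, aeval_X]
          positivity
        exact (isSemialgebraicFunOn_aeval_div_aeval r.isSemialgebraic_domain
          ((X 2 : MvPolynomial (Fin 3) ℚ) * (X 0 * X 1)) (X 0 ^ i * X 1 ^ j) hq).congr
          fun p _ => by
            simp only [map_mul, map_pow, aeval_X]
            rw [hΦ2]
    · -- differentiability within the source domain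
      intro x hx
      obtain ⟨hx0, hx1⟩ := hpos x hx
      refine HasFDerivAt.hasFDerivWithinAt (hasFDerivAt_pi'' fun k => ?_)
      fin_cases k
      · show HasFDerivAt (fun p => Φ p 0) ((ContinuousLinearMap.proj 0).comp (Φ' x)) x
        rw [ContinuousLinearMap.proj_pi]
        exact pmv_hasFDerivAt_pow 0 i x
      · show HasFDerivAt (fun p => Φ p 1) ((ContinuousLinearMap.proj 1).comp (Φ' x)) x
        rw [ContinuousLinearMap.proj_pi]
        exact pmv_hasFDerivAt_pow 1 j x
      · show HasFDerivAt (fun p => Φ p 2) ((ContinuousLinearMap.proj 2).comp (Φ' x)) x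
        rw [ContinuousLinearMap.proj_pi]
        exact pmv_hasFDerivAt_slack i j x hx0.ne' hx1.ne'
    · -- injectivity on the source domain
      intro p hp q hq hpq
      obtain ⟨hp0, hp1⟩ := hpos p hp
      obtain ⟨hq0, hq1⟩ := hpos q hq
      have e0 : p 0 ^ i = q 0 ^ i := by rw [← hΦ0 p, ← hΦ0 q, hpq]
      have e1 : p 1 ^ j = q 1 ^ j := by rw [← hΦ1 p, ← hΦ1 q, hpq]
      have e2 : p 2 * (p 0 * p 1) / (p 0 ^ i * p 1 ^ j) =
          q 2 * (q 0 * q 1) / (q 0 ^ i * q 1 ^ j) := by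
        rw [← hΦ2 p, ← hΦ2 q, hpq]
      have k0 : p 0 = q 0 := (pow_left_inj₀ hp0.le hq0.le hi0).1 e0
      have k1 : p 1 = q 1 := (pow_left_inj₀ hp1.le hq1.le hj0).1 e1
      rw [k0, k1] at e2
      have hc : q 0 ^ i * q 1 ^ j ≠ 0 := by positivity
      have hc' : q 0 * q 1 ≠ 0 := by positivity
      have k2 : p 2 = q 2 := mul_right_cancel₀ hc' ((div_left_inj' hc).1 e2)
      funext k
      fin_cases k
      exacts [k0, k1, k2]
    · -- the image is the target domain
      show r'.domain = Φ '' r.domain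
      refine Subset.antisymm (fun q hq => ?_) ?_
      · obtain ⟨p, hp, hpq⟩ := hsurj q hq
        exact ⟨p, hp, hpq⟩
      · rintro _ ⟨p, hp, rfl⟩
        exact hmaps p hp
    · -- the integrands: `(i·j) · 1 = 1 · |i·j|`
      intro x hx
      have hx' : x ∈ r.domain := hx
      show ((i * j : ℕ) : ℝ) * r.integrand x = r'.integrand (Φ x) * |(Φ' x).det|
      rw [hf x hx', hf' _ (hmaps x hx'), hdet x hx', Nat.cast_mul, mul_one, one_mul,
        abs_of_nonneg (by positivity)]
  -- combine with `[(i·j)·r] ≡ (i·j)•[r]`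
  have key := KZ.relations.sub_mem
    (KZ.IntegralRep.of_constMul_nat_sub_nsmul_mem_relations r (i * j))
    (KZ.changeOfVariablesRel_subset_relations hcov)
  rwa [sub_sub_sub_cancel_left] at key

end Summit.KontsevichZagierPeriods.SymplecticScissors.LogPolytope

end
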